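import Summits.QuantumFields.YangMills.Theorems.BalabanUVNodesN21ResponseRoadAtRegularSet
import Literature.MathematicalPhysics.QuantumFieldTheory.Balaban1983to89.B11Claim309UAnalytic

/-!
# N21 (NE7c) · THE MINIMISER AS `exp(iη𝓗(B))·U_k(V₀)` ([14] (112), (172)–(174)): the response road's NODE-O clause
# from Prop. 6's REGIME about every regular `V₀`, with PRINT'S EXPONENTIAL FINE CHART — unit values DERIVED, BY NAME

Width seat `pub-ymgap-dag-n21-w7` (g0′, harness re-seat; dag-lead WIDTH-209 N21 piece 1 «RADIAL TRANSVERSALITY (α)»,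
its [14]-regularity rung, fifth shape), node N21 = NE7c (NOT PRINTED in [Bałaban 1983–89], NOT proved), lane K3⁷
`SpineGivenEndpointR13SepCoPH` (stmt-QuantumFields-20544, `--kind proof --supports … --as helper`).  File 6 of this seat
(siblings: file 3 `…N21MinimiserResponseRegime` p616375 ✓ — ONE global chart `Φ z V` on the regular set; file 5
`…Prop6Letters` p618631 ✓); consumes BY NAME lit-balaban r08 g9's `B11Claim309UAnalytic.analyticOnNhd_chartH`
(«the equations determine an analytic function 𝓗»), `B11Eq174Chart` (`Regime`, `chartH`), n21-w3 f7
`…N21ExponentialChartFieldStrength` (`isOpen_regularConfigs`, `isOpen_unitConfigs`, `differentiableOn_plaqReading`,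
`isUnit_exp_complex`) and f8 `…N21ResponseRoadAtRegularSet` (p598568 ✓: ★★★ `hRT_of_blockExpChart_regular`); Mathlib
`NormedSpace.exp_analytic`.

PRINT.  [14] = T. Bałaban, CMP **102** (1985) 277–309.  Prop. 5 (112) p. 294: «All critical configurations `U₁` …
can be obtained from solutions of Eq. (111) … by the transformation `U₁ = exp iη[A₁ + H₁B − HD(A₁ + H₁B)]`»; Sect. G
p. 305: «take `V = V′V₀` … `V′ = e^{iB′}`, `|B′| < 2C₁ε₁` (172) … `U₀ = U_k(V₀)` … `U_k(V′V₀)U₀⁻¹ = U₁`, and we have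
`U₁ = exp iη𝓗(B)` … `𝓗` is represented as `… (𝒜₁ + H₁B)` (174) where `𝒜₁` satisfies the equation (175)»; p. 305:
«it is an analytic function of `B = (1∕i) log V` … The function on the right-hand side of (174) is an analytic
function of `𝒜₁ + H₁B`».  lit-balaban: `chartH 𝒢 Λ W J Tm ε₄ 𝔄 = Tm (solA … + 𝔄)` = 𝓗 with `Tm` the Sect. C map (47)
`A′ ↦ A′ − HD(A′)`, analytic in the parameter by `analyticOnNhd_chartH`.

WHY.  Files 3∕5 displayed ONE fine chart `Φ z V` on the whole regular set and a unit-value binder `hunit`.  Print's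
statement is LOCAL — about each regular `V₀` with background `U_k(V₀)` — and its chart is the EXPONENTIAL of a linear
presentation of `𝓗`: `U_k(V) = exp(L(𝓗_{V₀}(V)))·U_k(V₀)` on a neighbourhood `O z V₀` of `V₀` ((172)).  THIS FILE
types f8's clause from that local exponential reading: analyticity of `V ↦ 𝓗_{V₀}(V)` on `O z V₀` is r08's
`analyticOnNhd_chartH` under a uniform `Regime` with analytic data and analytic `Tm`; `exp` is entire and a unit
(`exp_analytic`, f7 `isUnit_exp_complex`), so differentiability at `V₀` AND unit values of `U_k(V)` FOLLOW — the
`hunit` binder of files 2∕3∕5 is DISCHARGED and `Φ` is print's, not posited.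

WHAT IS PROVED ([textbook] §1; [bookkeeping] BY NAME §2–§4; 0 def, 0 sorry).
* §1 `analyticAt_expFineChart` (`V ↦ (b ↦ exp (L (G V) b) · U₀ b)` analytic at a point where `G` is) ·
  `isUnit_expFineChart_apply` (its values are units when `U₀ b` is).
* §2 ★★-E `psiClause_differentiableOn_of_expChart` (abstract open `D`, abstract readings; local data about each
  `V₀ ∈ D` on open `O z V₀ ∋ V₀`; reading identity `Umin z V = exp(L z V₀ (𝓗 …)) · U₀ z V₀` on `O z V₀`) · ★★′-E
  `psiClause_plaqReading_of_expChart` = f8's `hΨd` VERBATIM on `Reg`, NO unit-value binder (derived from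
  `hU₀ : IsUnit (U₀ z V₀ b)` — the background `U_k(V₀)` is group-valued).
* §3 ★★★-E `hRT_of_blockExpChart_regular_of_expChart` = f8 ★★★ BY NAME, `hΨd := ★★′-E`; displayed instead: the open
  cover `O`, the `Regime` rows + data bounds + analyticity letters (`𝔊 Λ (δ∕δA′)V J H₁B`, `Tm`) on each `O z V₀`, the
  presentation `L`, the backgrounds `U₀` (units), the reading identity, and `hΨS` ([14] Thm 1 (8), LOCATED).
* §4 A2∕A6 `expChart_levelZero_witness`: the kept binder system is jointly inhabited in every `𝔄` (`O z V₀ = univ`,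
  zero data, `Regime 0 0 0 0 0 0 2 0 1 0`, `Tm = snd`, `L = 0`, `U₀ = 1`, `Umin = 1`; HONESTLY LABELLED level 0).

HONEST FRAMING.  [textbook]∕[bookkeeping]; the identification of `O z V₀` with (172)'s neighbourhood, of
`𝒢, Λ, W, J, AH, Tm` with [14]'s `𝔊`, linear term, `(δ∕δA′)V`, `J`, `H₁B`, (47)'s `T` AT NODE 00's objects (as functions
of `V` through `B = (1∕i) log(VV₀⁻¹)`), of `L` with «`iη ×` the bond-matrix presentation» and of `U₀ z V₀` with `U_k(V₀)`
is a LOCATED dictionary, NOT asserted (NODE O's ∕ the definers' objects); print takes the analyticity and bounds of the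
data from [4–6] (lit-balaban (M2)); (α) itself NOT PRINTED ∕ NOT proved; nothing of Bałaban's asserted; (M1) ∕ NE7c NOT
PRINTED ∕ NOT proved; N21 NOT discharged; K3⁷ NOT claimed; counts unmoved (typed 28∕28 · discharged 5∕27, A 5∕28);
count-neutral; one finite 𝕋⁴ at fixed ε — the Yang–Mills mass gap (Clay) is NOT proved by any of this: R4 would close
the conditional finite-𝕋⁴ rung `BalabanLadder.UV` only; nothing continuum ∕ ℝ⁴ ∕ OS ∕ mass gap ∕ Clay.
-/

noncomputable section

open Filter Set Metric NormedSpace MeasureTheory Matrix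
open scoped Topology ContDiff ENNReal

namespace Summit.QuantumFields.YangMills.Theorems.N21MinimiserResponseExpChart

open Literature.MathematicalPhysics.QuantumFieldTheory.Balaban1983to89.B11Eq174Chart (Regime solA chartH)
open Literature.MathematicalPhysics.QuantumFieldTheory.Balaban1983to89.B11Claim309UAnalytic (analyticOnNhd_chartH)
open Summit.QuantumFields.YangMills.Theorems.N21ExponentialChartFieldStrength
  (isOpen_unitConfigs isOpen_regularConfigs differentiableOn_plaqReading isUnit_exp_complex)
open Summit.QuantumFields.YangMills.Theorems.N21ResponseRoadAtRegularSet (hRT_of_blockExpChart_regular)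

/-! ## §1  The exponential fine chart: analytic where its exponent is; unit-valued -/

section ExpChart

variable {𝔄 : Type*} [NormedRing 𝔄] [NormedAlgebra ℂ 𝔄] [CompleteSpace 𝔄] {Bf : Type*} [Fintype Bf]
  {𝒰 𝒴 : Type*} [NormedAddCommGroup 𝒰] [NormedSpace ℂ 𝒰] [NormedAddCommGroup 𝒴] [NormedSpace ℂ 𝒴]

/-- **THE EXPONENTIAL FINE CHART IS ANALYTIC WHERE ITS EXPONENT IS**: for `G : 𝒰 → 𝒴` analytic at `u`, a continuous
linear presentation `L : 𝒴 →L[ℂ] (Bf → 𝔄)` and a background `U₀ : Bf → 𝔄`, the configuration-valued map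
`u ↦ (b ↦ exp (L (G u) b) · U₀ b)` is analytic at `u` (coordinatewise: `exp` is entire — Mathlib `exp_analytic` —
composed with the `b`-coordinate of `L ∘ G`, times a constant).  Print: (112) ∕ Sect. G «`U₁ = exp iη𝓗(B)`»,
«an analytic function of `𝒜₁ + H₁B`». [cite: Balaban1985Variational, (112) p.294, (174) p.305] [textbook] -/
theorem analyticAt_expFineChart {G : 𝒰 → 𝒴} {u : 𝒰} (hG : AnalyticAt ℂ G u) (L : 𝒴 →L[ℂ] (Bf → 𝔄))
    (U₀ : Bf → 𝔄) : AnalyticAt ℂ (fun u' : 𝒰 => fun b : Bf => exp (L (G u') b) * U₀ b) u := by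
  refine AnalyticAt.pi fun b => ?_
  have hLb : AnalyticAt ℂ (fun u' : 𝒰 => L (G u') b) u :=
    ((ContinuousLinearMap.proj (R := ℂ) (φ := fun _ : Bf => 𝔄) b).comp L).analyticAt _ |>.comp hG
  have hE : AnalyticAt ℂ (fun u' : 𝒰 => exp (L (G u') b)) u :=
    AnalyticAt.comp (g := exp) (f := fun u' : 𝒰 => L (G u') b) (x := u) (exp_analytic (𝕂 := ℂ) _) hLb
  exact hE.mul analyticAt_const

omit [Fintype Bf] [NormedAddCommGroup 𝒰] [NormedSpace ℂ 𝒰] in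
/-- **THE EXPONENTIAL FINE CHART IS UNIT-VALUED**: `exp (L Y b) · U₀ b` is a unit whenever the background bond variable
`U₀ b` is (`exp` of anything is a unit — f7 `isUnit_exp_complex`).  Print: `U_k(V) = U₁U₀`, `U₁ = exp iη𝓗`,
`U₀ = U_k(V₀) ∈ G`. [cite: Balaban1985Variational, p.305] [textbook] -/
theorem isUnit_expFineChart_apply (L : 𝒴 →L[ℂ] (Bf → 𝔄)) {U₀ : Bf → 𝔄} (hU₀ : ∀ b, IsUnit (U₀ b)) (Y : 𝒴)
    (b : Bf) : IsUnit (exp (L Y b) * U₀ b) :=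
  (isUnit_exp_complex _).mul (hU₀ b)

end ExpChart

/-! ## §2  The response road's NODE-O clause from the local exponential reading of the minimiser -/

section PsiClause

variable {𝔄 : Type*} [NormedRing 𝔄] [NormedAlgebra ℂ 𝔄] [CompleteSpace 𝔄]
  {B : Type*} [Fintype B] {Z P : Type*} {Bf : Type*} [Fintype Bf]
  {𝒴 𝒵 : Type*} [NormedAddCommGroup 𝒴] [NormedSpace ℂ 𝒴] [CompleteSpace 𝒴]
  [NormedAddCommGroup 𝒵] [NormedSpace ℂ 𝒵] [CompleteSpace 𝒵]
  {E : Type*} [NormedAddCommGroup E] [NormedSpace ℂ E]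

/-- ★★-E **READINGS OF THE MINIMISER ARE DIFFERENTIABLE, FROM THE LOCAL EXPONENTIAL READING** (abstract open set `D`
of block data): about each `V₀ ∈ D` an open `O z V₀ ∋ V₀` ((172)'s neighbourhood) carrying data
`𝒢 Λ W J AH Tm` (print's `𝔊`, linear term, `(δ∕δA′)V`, `J`, `H₁B`, (47)'s `T` — functions of `V` through
`B = (1∕i)log(VV₀⁻¹)`) under a UNIFORM `Regime` with data bounds and analyticity on `O z V₀`, a presentation
`L z V₀ : 𝒴 →L[ℂ] (Bf → 𝔄)` («`iη ×`»), a background `U₀ z V₀` («`U_k(V₀)`») and the reading identity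
`U_k(V) = exp(L 𝓗_{V₀}(V)) · U_k(V₀)` on `O z V₀` (`𝓗 = chartH …`, (112)∕(174)); readings `read q` ℂ-differentiable at
the values ⇒ `V ↦ read q (Umin z V)` is ℂ-differentiable on `D` (r08 `analyticOnNhd_chartH` + §1 + local congruence).
[cite: Balaban1985Variational, (112) p.294, (172)-(175) p.305, p.309] [bookkeeping] -/
theorem psiClause_differentiableOn_of_expChart {D : Set (B → 𝔄)}
    (O : Z → (B → 𝔄) → Set (B → 𝔄)) (hO : ∀ z, ∀ V₀ ∈ D, IsOpen (O z V₀) ∧ V₀ ∈ O z V₀)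
    (𝒢 : Z → (B → 𝔄) → (B → 𝔄) → (𝒵 →L[ℂ] 𝒴)) (Λ : Z → (B → 𝔄) → (B → 𝔄) → (𝒴 →L[ℂ] 𝒴))
    (W : Z → (B → 𝔄) → (B → 𝔄) → 𝒴 → 𝒵) (J : Z → (B → 𝔄) → (B → 𝔄) → 𝒵) (AH : Z → (B → 𝔄) → (B → 𝔄) → 𝒴)
    (Tm : Z → (B → 𝔄) → (B → 𝔄) → 𝒴 → 𝒴) {B₀ θ C₄ a₃ j a ε₄ : ℝ}
    (R : ∀ z, ∀ V₀ ∈ D, ∀ V ∈ O z V₀, Regime (𝒢 z V₀ V) (Λ z V₀ V) (W z V₀ V) B₀ θ C₄ a₃ j a ε₄)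
    (hJb : ∀ z, ∀ V₀ ∈ D, ∀ V ∈ O z V₀, ‖J z V₀ V‖ ≤ j) (hAb : ∀ z, ∀ V₀ ∈ D, ∀ V ∈ O z V₀, ‖AH z V₀ V‖ < a)
    (h𝒢 : ∀ z, ∀ V₀ ∈ D, AnalyticOnNhd ℂ (𝒢 z V₀) (O z V₀)) (hΛ : ∀ z, ∀ V₀ ∈ D, AnalyticOnNhd ℂ (Λ z V₀) (O z V₀))
    (hW : ∀ z, ∀ V₀ ∈ D, AnalyticOnNhd ℂ (fun p : (B → 𝔄) × 𝒴 => W z V₀ p.1 p.2) (O z V₀ ×ˢ {Y : 𝒴 | ‖Y‖ < a₃}))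
    (hJ : ∀ z, ∀ V₀ ∈ D, AnalyticOnNhd ℂ (J z V₀) (O z V₀)) (hA : ∀ z, ∀ V₀ ∈ D, AnalyticOnNhd ℂ (AH z V₀) (O z V₀))
    (hTm : ∀ z, ∀ V₀ ∈ D, AnalyticOnNhd ℂ (fun p : (B → 𝔄) × 𝒴 => Tm z V₀ p.1 p.2)
      (O z V₀ ×ˢ {Y : 𝒴 | ‖Y‖ < ε₄ + a}))
    (L : Z → (B → 𝔄) → (𝒴 →L[ℂ] (Bf → 𝔄))) (U₀ : Z → (B → 𝔄) → (Bf → 𝔄)) (Umin : Z → (B → 𝔄) → (Bf → 𝔄))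
    (hUmin : ∀ z, ∀ V₀ ∈ D, ∀ V ∈ O z V₀, Umin z V = fun b =>
      exp (L z V₀ (chartH (𝒢 z V₀ V) (Λ z V₀ V) (W z V₀ V) (J z V₀ V) (Tm z V₀ V) ε₄ (AH z V₀ V)) b) * U₀ z V₀ b)
    (read : P → (Bf → 𝔄) → E) (hread : ∀ q z, ∀ V ∈ D, DifferentiableAt ℂ (read q) (Umin z V)) :
    ∀ q z, DifferentiableOn ℂ (fun V => read q (Umin z V)) D := by
  intro q z V₀ hV₀
  obtain ⟨hOo, hV₀O⟩ := hO z V₀ hV₀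
  -- r08: `V ↦ 𝓗_{V₀}(V)` is analytic on the neighbourhood `O z V₀`
  have hH : AnalyticOnNhd ℂ (fun V : B → 𝔄 =>
      chartH (𝒢 z V₀ V) (Λ z V₀ V) (W z V₀ V) (J z V₀ V) (Tm z V₀ V) ε₄ (AH z V₀ V)) (O z V₀) :=
    analyticOnNhd_chartH hOo (R z V₀ hV₀) (hJb z V₀ hV₀) (hAb z V₀ hV₀) (h𝒢 z V₀ hV₀) (hΛ z V₀ hV₀) (hW z V₀ hV₀)
      (hJ z V₀ hV₀) (hA z V₀ hV₀) (hTm z V₀ hV₀)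
  -- §1: the exponential reading is analytic at `V₀`; `Umin z` agrees with it near `V₀`
  have hexp := analyticAt_expFineChart (hH V₀ hV₀O) (L z V₀) (U₀ z V₀)
  have heq : Umin z =ᶠ[𝓝 V₀] fun V => fun b =>
      exp (L z V₀ (chartH (𝒢 z V₀ V) (Λ z V₀ V) (W z V₀ V) (J z V₀ V) (Tm z V₀ V) ε₄ (AH z V₀ V)) b) * U₀ z V₀ b := by
    filter_upwards [hOo.mem_nhds hV₀O] with V hV using hUmin z V₀ hV₀ V hV
  have hU : DifferentiableAt ℂ (Umin z) V₀ := (heq.differentiableAt_iff).mpr hexp.differentiableAt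
  exact ((hread q z V₀ hV₀).comp V₀ hU).differentiableWithinAt

/-- ★★′-E **THE PLAQUETTE READINGS OF THE MINIMISER, FROM THE LOCAL EXPONENTIAL READING** — f8's `hΨd` VERBATIM for
`Ψ q z V := ∂(Umin z V)(q) − 1` on `Reg = {V | (∀ b, IsUnit (V b)) ∧ ∀ p ∈ plaqs, ‖∂V(p) − 1‖ < ε}`, with NO unit-value
binder: on `Reg` every `Umin z V = exp(L 𝓗_V(V)) · U_k(V)`-shaped value is a unit because the backgrounds are
(`hU₀`); ★★-E + f7 `differentiableOn_plaqReading` + §1 `isUnit_expFineChart_apply`.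
[cite: Balaban1985Variational, (112) p.294, (172)-(175) p.305] [bookkeeping] -/
theorem psiClause_plaqReading_of_expChart (plaqs : Finset (B × B × B × B)) (ε : ℝ)
    (O : Z → (B → 𝔄) → Set (B → 𝔄))
    (hO : ∀ z, ∀ V₀ ∈ {V : B → 𝔄 | (∀ b, IsUnit (V b)) ∧ ∀ p ∈ plaqs,
      ‖V p.1 * V p.2.1 * Ring.inverse (V p.2.2.1) * Ring.inverse (V p.2.2.2) - 1‖ < ε}, IsOpen (O z V₀) ∧ V₀ ∈ O z V₀)
    (𝒢 : Z → (B → 𝔄) → (B → 𝔄) → (𝒵 →L[ℂ] 𝒴)) (Λ : Z → (B → 𝔄) → (B → 𝔄) → (𝒴 →L[ℂ] 𝒴))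
    (W : Z → (B → 𝔄) → (B → 𝔄) → 𝒴 → 𝒵) (J : Z → (B → 𝔄) → (B → 𝔄) → 𝒵) (AH : Z → (B → 𝔄) → (B → 𝔄) → 𝒴)
    (Tm : Z → (B → 𝔄) → (B → 𝔄) → 𝒴 → 𝒴) {B₀ θ C₄ a₃ j a ε₄ : ℝ}
    (R : ∀ z, ∀ V₀ ∈ {V : B → 𝔄 | (∀ b, IsUnit (V b)) ∧ ∀ p ∈ plaqs,
      ‖V p.1 * V p.2.1 * Ring.inverse (V p.2.2.1) * Ring.inverse (V p.2.2.2) - 1‖ < ε}, ∀ V ∈ O z V₀,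
      Regime (𝒢 z V₀ V) (Λ z V₀ V) (W z V₀ V) B₀ θ C₄ a₃ j a ε₄)
    (hJb : ∀ z, ∀ V₀ ∈ {V : B → 𝔄 | (∀ b, IsUnit (V b)) ∧ ∀ p ∈ plaqs,
      ‖V p.1 * V p.2.1 * Ring.inverse (V p.2.2.1) * Ring.inverse (V p.2.2.2) - 1‖ < ε}, ∀ V ∈ O z V₀, ‖J z V₀ V‖ ≤ j)
    (hAb : ∀ z, ∀ V₀ ∈ {V : B → 𝔄 | (∀ b, IsUnit (V b)) ∧ ∀ p ∈ plaqs,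
      ‖V p.1 * V p.2.1 * Ring.inverse (V p.2.2.1) * Ring.inverse (V p.2.2.2) - 1‖ < ε}, ∀ V ∈ O z V₀, ‖AH z V₀ V‖ < a)
    (h𝒢 : ∀ z, ∀ V₀ ∈ {V : B → 𝔄 | (∀ b, IsUnit (V b)) ∧ ∀ p ∈ plaqs,
      ‖V p.1 * V p.2.1 * Ring.inverse (V p.2.2.1) * Ring.inverse (V p.2.2.2) - 1‖ < ε}, AnalyticOnNhd ℂ (𝒢 z V₀) (O z V₀))
    (hΛ : ∀ z, ∀ V₀ ∈ {V : B → 𝔄 | (∀ b, IsUnit (V b)) ∧ ∀ p ∈ plaqs,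
      ‖V p.1 * V p.2.1 * Ring.inverse (V p.2.2.1) * Ring.inverse (V p.2.2.2) - 1‖ < ε}, AnalyticOnNhd ℂ (Λ z V₀) (O z V₀))
    (hW : ∀ z, ∀ V₀ ∈ {V : B → 𝔄 | (∀ b, IsUnit (V b)) ∧ ∀ p ∈ plaqs,
      ‖V p.1 * V p.2.1 * Ring.inverse (V p.2.2.1) * Ring.inverse (V p.2.2.2) - 1‖ < ε},
      AnalyticOnNhd ℂ (fun p : (B → 𝔄) × 𝒴 => W z V₀ p.1 p.2) (O z V₀ ×ˢ {Y : 𝒴 | ‖Y‖ < a₃}))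
    (hJ : ∀ z, ∀ V₀ ∈ {V : B → 𝔄 | (∀ b, IsUnit (V b)) ∧ ∀ p ∈ plaqs,
      ‖V p.1 * V p.2.1 * Ring.inverse (V p.2.2.1) * Ring.inverse (V p.2.2.2) - 1‖ < ε}, AnalyticOnNhd ℂ (J z V₀) (O z V₀))
    (hA : ∀ z, ∀ V₀ ∈ {V : B → 𝔄 | (∀ b, IsUnit (V b)) ∧ ∀ p ∈ plaqs,
      ‖V p.1 * V p.2.1 * Ring.inverse (V p.2.2.1) * Ring.inverse (V p.2.2.2) - 1‖ < ε}, AnalyticOnNhd ℂ (AH z V₀) (O z V₀))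
    (hTm : ∀ z, ∀ V₀ ∈ {V : B → 𝔄 | (∀ b, IsUnit (V b)) ∧ ∀ p ∈ plaqs,
      ‖V p.1 * V p.2.1 * Ring.inverse (V p.2.2.1) * Ring.inverse (V p.2.2.2) - 1‖ < ε},
      AnalyticOnNhd ℂ (fun p : (B → 𝔄) × 𝒴 => Tm z V₀ p.1 p.2) (O z V₀ ×ˢ {Y : 𝒴 | ‖Y‖ < ε₄ + a}))
    (L : Z → (B → 𝔄) → (𝒴 →L[ℂ] (Bf → 𝔄))) (U₀ : Z → (B → 𝔄) → (Bf → 𝔄))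
    (hU₀ : ∀ z, ∀ V₀ ∈ {V : B → 𝔄 | (∀ b, IsUnit (V b)) ∧ ∀ p ∈ plaqs,
      ‖V p.1 * V p.2.1 * Ring.inverse (V p.2.2.1) * Ring.inverse (V p.2.2.2) - 1‖ < ε}, ∀ b, IsUnit (U₀ z V₀ b))
    (Umin : Z → (B → 𝔄) → (Bf → 𝔄))
    (hUmin : ∀ z, ∀ V₀ ∈ {V : B → 𝔄 | (∀ b, IsUnit (V b)) ∧ ∀ p ∈ plaqs,
      ‖V p.1 * V p.2.1 * Ring.inverse (V p.2.2.1) * Ring.inverse (V p.2.2.2) - 1‖ < ε}, ∀ V ∈ O z V₀, Umin z V = fun b =>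
      exp (L z V₀ (chartH (𝒢 z V₀ V) (Λ z V₀ V) (W z V₀ V) (J z V₀ V) (Tm z V₀ V) ε₄ (AH z V₀ V)) b) * U₀ z V₀ b) :
    ∀ (q : Bf × Bf × Bf × Bf) (z : Z), DifferentiableOn ℂ
      (fun V => Umin z V q.1 * Umin z V q.2.1 * Ring.inverse (Umin z V q.2.2.1) * Ring.inverse (Umin z V q.2.2.2) - 1)
      {V : B → 𝔄 | (∀ b, IsUnit (V b)) ∧ ∀ p ∈ plaqs,
        ‖V p.1 * V p.2.1 * Ring.inverse (V p.2.2.1) * Ring.inverse (V p.2.2.2) - 1‖ < ε} := by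
  -- unit values on `Reg`, DERIVED: at `V₀ := V ∈ O z V` the reading is an exponential times a unit background
  have hunit : ∀ z, ∀ V ∈ {V : B → 𝔄 | (∀ b, IsUnit (V b)) ∧ ∀ p ∈ plaqs,
      ‖V p.1 * V p.2.1 * Ring.inverse (V p.2.2.1) * Ring.inverse (V p.2.2.2) - 1‖ < ε}, ∀ b, IsUnit (Umin z V b) := by
    intro z V hV b
    rw [hUmin z V hV V (hO z V hV).2]
    exact isUnit_expFineChart_apply (L z V) (hU₀ z V hV) _ b
  exact psiClause_differentiableOn_of_expChart O hO 𝒢 Λ W J AH Tm R hJb hAb h𝒢 hΛ hW hJ hA hTm L U₀ Umin hUmin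
    (fun q (U : Bf → 𝔄) => U q.1 * U q.2.1 * Ring.inverse (U q.2.2.1) * Ring.inverse (U q.2.2.2) - 1)
    (fun q z V hV => ((differentiableOn_plaqReading (𝔄 := 𝔄) q).differentiableAt
      (isOpen_unitConfigs.mem_nhds (hunit z V hV))).sub_const 1)

end PsiClause

/-! ## §3  Junction BY NAME: part 34's `hRT` through the exponential block chart, `hΨd` DISCHARGED into the local reading -/

section Junction

variable {𝔄 : Type*} [NormedRing 𝔄] [NormedAlgebra ℂ 𝔄] [CompleteSpace 𝔄] [NormOneClass 𝔄]
  {κ B Bf : Type*} [Fintype κ] [Fintype B] [Fintype Bf] {Z : Type*}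
  {𝒴 𝒵 : Type*} [NormedAddCommGroup 𝒴] [NormedSpace ℂ 𝒴] [CompleteSpace 𝒴]
  [NormedAddCommGroup 𝒵] [NormedSpace ℂ 𝒵] [CompleteSpace 𝒵]

/-- ★★★-E **PART 34's `hRT` THROUGH THE EXPONENTIAL BLOCK CHART, THE NODE-O CLAUSE's DIFFERENTIABILITY HALF DISCHARGED
INTO THE LOCAL EXPONENTIAL READING `U_k(V) = exp(iη𝓗_{V₀}(V))·U_k(V₀)`** — f8 ★★★ `hRT_of_blockExpChart_regular` BY NAME
at `Ψ q z V := ∂(Umin z V)(q) − 1` with `hΨd := ★★′-E`; displayed instead: the cover `O`, the `Regime` rows, data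
bounds and analyticity letters on each `O z V₀`, `L`, unit backgrounds `U₀`, the reading identity, and `hΨS` ([14] Thm 1
(8), LOCATED); every other binder of f8 verbatim; (α) NOT proved.
[cite: Balaban1985Variational, (112) p.294, (172)-(175) p.305, Thm 1 (8) p.279] [bookkeeping] -/
theorem hRT_of_blockExpChart_regular_of_expChart [Nonempty Bf]
    (Xd : Z → κ → B → 𝔄) (V₀ : Z → B → 𝔄ˣ)
    {Ξ v v' r S δ ε ϱ R c₀ θ ρ κ₀ : ℝ} (hΞ0 : 0 ≤ Ξ) (hΞ : ∀ z b, ∑ a, ‖Xd z a b‖ ≤ Ξ) (hv0 : 0 ≤ v)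
    (hv : ∀ z b, ‖(V₀ z b : 𝔄)‖ ≤ v) (hv' : ∀ z b, ‖(↑(V₀ z b)⁻¹ : 𝔄)‖ ≤ v') (hr : 0 < r) (hS0 : 0 ≤ S)
    (hsmall : Ξ * Real.exp ((ϱ + r) * Ξ) * v * r * (v' * Real.exp (ϱ * Ξ)) ≤ 1 / 2)
    (plaqs : Finset (B × B × B × B))
    (hbudget : δ + max (Real.exp (ϱ * Ξ) * v + Ξ * Real.exp ((ϱ + r) * Ξ) * v * r)
        (2 * (v' * Real.exp (ϱ * Ξ))) ^ 3 * (2 + 4 * (v' * Real.exp (ϱ * Ξ)) ^ 2) *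
        (Ξ * Real.exp ((ϱ + r) * Ξ) * v * r) < ε)
    (O : Z → (B → 𝔄) → Set (B → 𝔄))
    (hO : ∀ z, ∀ W₀ ∈ {V : B → 𝔄 | (∀ b, IsUnit (V b)) ∧ ∀ p ∈ plaqs,
      ‖V p.1 * V p.2.1 * Ring.inverse (V p.2.2.1) * Ring.inverse (V p.2.2.2) - 1‖ < ε}, IsOpen (O z W₀) ∧ W₀ ∈ O z W₀)
    (𝒢 : Z → (B → 𝔄) → (B → 𝔄) → (𝒵 →L[ℂ] 𝒴)) (Λ : Z → (B → 𝔄) → (B → 𝔄) → (𝒴 →L[ℂ] 𝒴))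
    (W : Z → (B → 𝔄) → (B → 𝔄) → 𝒴 → 𝒵) (J : Z → (B → 𝔄) → (B → 𝔄) → 𝒵) (AH : Z → (B → 𝔄) → (B → 𝔄) → 𝒴)
    (Tm : Z → (B → 𝔄) → (B → 𝔄) → 𝒴 → 𝒴) {B₀ θ₁ C₄ a₃ j a ε₄ : ℝ}
    (hR : ∀ z, ∀ W₀ ∈ {V : B → 𝔄 | (∀ b, IsUnit (V b)) ∧ ∀ p ∈ plaqs,
      ‖V p.1 * V p.2.1 * Ring.inverse (V p.2.2.1) * Ring.inverse (V p.2.2.2) - 1‖ < ε}, ∀ V ∈ O z W₀, Regime (𝒢 z W₀ V) (Λ z W₀ V) (W z W₀ V) B₀ θ₁ C₄ a₃ j a ε₄)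
    (hJb : ∀ z, ∀ W₀ ∈ {V : B → 𝔄 | (∀ b, IsUnit (V b)) ∧ ∀ p ∈ plaqs,
      ‖V p.1 * V p.2.1 * Ring.inverse (V p.2.2.1) * Ring.inverse (V p.2.2.2) - 1‖ < ε}, ∀ V ∈ O z W₀, ‖J z W₀ V‖ ≤ j)
    (hAb : ∀ z, ∀ W₀ ∈ {V : B → 𝔄 | (∀ b, IsUnit (V b)) ∧ ∀ p ∈ plaqs,
      ‖V p.1 * V p.2.1 * Ring.inverse (V p.2.2.1) * Ring.inverse (V p.2.2.2) - 1‖ < ε}, ∀ V ∈ O z W₀, ‖AH z W₀ V‖ < a)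
    (h𝒢 : ∀ z, ∀ W₀ ∈ {V : B → 𝔄 | (∀ b, IsUnit (V b)) ∧ ∀ p ∈ plaqs,
      ‖V p.1 * V p.2.1 * Ring.inverse (V p.2.2.1) * Ring.inverse (V p.2.2.2) - 1‖ < ε}, AnalyticOnNhd ℂ (𝒢 z W₀) (O z W₀))
    (hΛ : ∀ z, ∀ W₀ ∈ {V : B → 𝔄 | (∀ b, IsUnit (V b)) ∧ ∀ p ∈ plaqs,
      ‖V p.1 * V p.2.1 * Ring.inverse (V p.2.2.1) * Ring.inverse (V p.2.2.2) - 1‖ < ε}, AnalyticOnNhd ℂ (Λ z W₀) (O z W₀))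
    (hW : ∀ z, ∀ W₀ ∈ {V : B → 𝔄 | (∀ b, IsUnit (V b)) ∧ ∀ p ∈ plaqs,
      ‖V p.1 * V p.2.1 * Ring.inverse (V p.2.2.1) * Ring.inverse (V p.2.2.2) - 1‖ < ε},
      AnalyticOnNhd ℂ (fun p : (B → 𝔄) × 𝒴 => W z W₀ p.1 p.2) (O z W₀ ×ˢ {Y : 𝒴 | ‖Y‖ < a₃}))
    (hJ : ∀ z, ∀ W₀ ∈ {V : B → 𝔄 | (∀ b, IsUnit (V b)) ∧ ∀ p ∈ plaqs,
      ‖V p.1 * V p.2.1 * Ring.inverse (V p.2.2.1) * Ring.inverse (V p.2.2.2) - 1‖ < ε}, AnalyticOnNhd ℂ (J z W₀) (O z W₀))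
    (hA : ∀ z, ∀ W₀ ∈ {V : B → 𝔄 | (∀ b, IsUnit (V b)) ∧ ∀ p ∈ plaqs,
      ‖V p.1 * V p.2.1 * Ring.inverse (V p.2.2.1) * Ring.inverse (V p.2.2.2) - 1‖ < ε}, AnalyticOnNhd ℂ (AH z W₀) (O z W₀))
    (hTm : ∀ z, ∀ W₀ ∈ {V : B → 𝔄 | (∀ b, IsUnit (V b)) ∧ ∀ p ∈ plaqs,
      ‖V p.1 * V p.2.1 * Ring.inverse (V p.2.2.1) * Ring.inverse (V p.2.2.2) - 1‖ < ε},
      AnalyticOnNhd ℂ (fun p : (B → 𝔄) × 𝒴 => Tm z W₀ p.1 p.2) (O z W₀ ×ˢ {Y : 𝒴 | ‖Y‖ < ε₄ + a}))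
    (L : Z → (B → 𝔄) → (𝒴 →L[ℂ] (Bf → 𝔄))) (U₀ : Z → (B → 𝔄) → (Bf → 𝔄))
    (hU₀ : ∀ z, ∀ W₀ ∈ {V : B → 𝔄 | (∀ b, IsUnit (V b)) ∧ ∀ p ∈ plaqs,
      ‖V p.1 * V p.2.1 * Ring.inverse (V p.2.2.1) * Ring.inverse (V p.2.2.2) - 1‖ < ε}, ∀ b, IsUnit (U₀ z W₀ b))
    (Umin : Z → (B → 𝔄) → (Bf → 𝔄))
    (hUmin : ∀ z, ∀ W₀ ∈ {V : B → 𝔄 | (∀ b, IsUnit (V b)) ∧ ∀ p ∈ plaqs,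
      ‖V p.1 * V p.2.1 * Ring.inverse (V p.2.2.1) * Ring.inverse (V p.2.2.2) - 1‖ < ε}, ∀ V ∈ O z W₀, Umin z V = fun b =>
      exp (L z W₀ (chartH (𝒢 z W₀ V) (Λ z W₀ V) (W z W₀ V) (J z W₀ V) (Tm z W₀ V) ε₄ (AH z W₀ V)) b) * U₀ z W₀ b)
    (hΨS : ∀ (q : Bf × Bf × Bf × Bf) z, ∀ V ∈ {V : B → 𝔄 | (∀ b, IsUnit (V b)) ∧ ∀ p ∈ plaqs,
      ‖V p.1 * V p.2.1 * Ring.inverse (V p.2.2.1) * Ring.inverse (V p.2.2.2) - 1‖ < ε},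
      ‖Umin z V q.1 * Umin z V q.2.1 * Ring.inverse (Umin z V q.2.2.1) * Ring.inverse (Umin z V q.2.2.2) - 1‖ ≤ S)
    (Kc : Z → Set (κ → ℝ)) (hKϱ : ∀ z, ∀ x ∈ Kc z, ‖x‖ ≤ ϱ)
    (hreg : ∀ z, ∀ x ∈ Kc z, ∀ p ∈ plaqs,
      ‖exp (∑ a, (x a : ℂ) • Xd z a p.1) * (V₀ z p.1 : 𝔄) * (exp (∑ a, (x a : ℂ) • Xd z a p.2.1) * (V₀ z p.2.1 : 𝔄)) *
        Ring.inverse (exp (∑ a, (x a : ℂ) • Xd z a p.2.2.1) * (V₀ z p.2.2.1 : 𝔄)) *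
        Ring.inverse (exp (∑ a, (x a : ℂ) • Xd z a p.2.2.2) * (V₀ z p.2.2.2 : 𝔄)) - 1‖ ≤ δ)
    (c : Z → (κ → ℝ)) (hcK : ∀ z, c z ∈ Kc z) (hKR : ∀ z, ∀ w ∈ Kc z, ‖w - c z‖ ≤ R) (hRr : 2 * R < r)
    (hc₀ : ∀ (q : Bf × Bf × Bf × Bf) z,
      ‖Umin z (fun b => exp (∑ a, ((c z a : ℝ) : ℂ) • Xd z a b) * (V₀ z b : 𝔄)) q.1 *
        Umin z (fun b => exp (∑ a, ((c z a : ℝ) : ℂ) • Xd z a b) * (V₀ z b : 𝔄)) q.2.1 *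
        Ring.inverse (Umin z (fun b => exp (∑ a, ((c z a : ℝ) : ℂ) • Xd z a b) * (V₀ z b : 𝔄)) q.2.2.1) *
        Ring.inverse (Umin z (fun b => exp (∑ a, ((c z a : ℝ) : ℂ) • Xd z a b) * (V₀ z b : 𝔄)) q.2.2.2) - 1‖ ≤ c₀)
    {C : Set (Z × (κ → ℝ))} (hCK : ∀ p ∈ C, p.2 ∈ Kc p.1)
    (hnum : c₀ + 4 * (2 * (2 * S) / r ^ 2) * R ^ 2 ≤ (1 - κ₀) * (θ * (1 - ρ))) :
    let Ψ : (Bf × Bf × Bf × Bf) → Z → (B → 𝔄) → 𝔄 := fun q z V =>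
      Umin z V q.1 * Umin z V q.2.1 * Ring.inverse (Umin z V q.2.2.1) * Ring.inverse (Umin z V q.2.2.2) - 1
    ∀ p : Z × (κ → ℝ), θ * (1 - ρ) ≤ (⨆ q, ‖Ψ q p.1 (fun b => exp (∑ a, ((p.2 a : ℝ) : ℂ) • Xd p.1 a b) * (V₀ p.1 b : 𝔄))‖) → (⨆ q, ‖Ψ q p.1 (fun b => exp (∑ a, ((p.2 a : ℝ) : ℂ) • Xd p.1 a b) * (V₀ p.1 b : 𝔄))‖) < θ → p ∈ C → ∀ s : ℝ, 1 ≤ s →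
      θ * (1 - ρ) ≤ (⨆ q, ‖Ψ q p.1 (fun b => exp (∑ a, (((c p.1 + s • (p.2 - c p.1)) a : ℝ) : ℂ) • Xd p.1 a b) * (V₀ p.1 b : 𝔄))‖) → (⨆ q, ‖Ψ q p.1 (fun b => exp (∑ a, (((c p.1 + s • (p.2 - c p.1)) a : ℝ) : ℂ) • Xd p.1 a b) * (V₀ p.1 b : 𝔄))‖) < θ → (p.1, c p.1 + s • (p.2 - c p.1)) ∈ C →
        (⨆ q, ‖Ψ q p.1 (fun b => exp (∑ a, ((p.2 a : ℝ) : ℂ) • Xd p.1 a b) * (V₀ p.1 b : 𝔄))‖) + κ₀ * (θ * (1 - ρ)) * (s - 1) ≤ (⨆ q, ‖Ψ q p.1 (fun b => exp (∑ a, (((c p.1 + s • (p.2 - c p.1)) a : ℝ) : ℂ) • Xd p.1 a b) * (V₀ p.1 b : 𝔄))‖) := by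
  intro Ψ
  exact hRT_of_blockExpChart_regular Xd V₀ hΞ0 hΞ hv0 hv hv' hr hS0 hsmall plaqs hbudget Ψ
    (psiClause_plaqReading_of_expChart plaqs ε O hO 𝒢 Λ W J AH Tm hR hJb hAb h𝒢 hΛ hW hJ hA hTm L U₀ hU₀ Umin hUmin)
    (fun q z V hV => hΨS q z V hV) Kc hKϱ hreg c hcK hKR hRr (fun q z => hc₀ q z) hCK hnum

end Junction

/-! ## §4  A2∕A6: the binder system of ★★′-E ∕ ★★★-E is jointly inhabited in every `𝔄` — the level-0 data -/

section Witness

variable {𝔄 : Type*} [NormedRing 𝔄] [NormedAlgebra ℂ 𝔄] {B : Type*} [Fintype B] {Z : Type*}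

/-- **A2∕A6 — THE LEVEL-0 DATA INHABIT THE BINDER SYSTEM KEPT BY ★★′-E ∕ ★★★-E**: carriers `𝒴 = 𝒵 := B → 𝔄`, fine
variables = block variables; cover `O z V₀ := univ`; ZERO data `𝔊 = 0`, `Λ = 0`, `(δ∕δA′)V = 0`, `J = 0`, `H₁B = 0`;
letters `Regime 0 0 0 0 0 0 2 0 1 0`; `Tm z V₀ V Y := Y`; presentation `L := 0`; background `U₀ := 1`; selector
`Umin := 1` (so `Umin z V = exp (0) · 1`): all binders this file introduces (cover, regime rows, data bounds, the six
analyticity letters, unit backgrounds, reading identity) hold — in EVERY `𝔄`.  HONESTLY LABELLED level 0: the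
genuine data, `iη ×`, `U_k(V₀)` and (172)'s neighbourhood AT NODE 00's objects are NODE O's ∕ the definers' objects;
nothing about them is asserted; f8's remaining binders (`hΨS`, budgets, cut letters) untouched. [bookkeeping] -/
theorem expChart_levelZero_witness (plaqs : Finset (B × B × B × B)) (ε : ℝ) :
    ∃ (O : Z → (B → 𝔄) → Set (B → 𝔄)) (𝒢 : Z → (B → 𝔄) → (B → 𝔄) → ((B → 𝔄) →L[ℂ] (B → 𝔄)))
      (Λ : Z → (B → 𝔄) → (B → 𝔄) → ((B → 𝔄) →L[ℂ] (B → 𝔄))) (W : Z → (B → 𝔄) → (B → 𝔄) → (B → 𝔄) → (B → 𝔄))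
      (J : Z → (B → 𝔄) → (B → 𝔄) → (B → 𝔄)) (AH : Z → (B → 𝔄) → (B → 𝔄) → (B → 𝔄))
      (Tm : Z → (B → 𝔄) → (B → 𝔄) → (B → 𝔄) → (B → 𝔄)) (L : Z → (B → 𝔄) → ((B → 𝔄) →L[ℂ] (B → 𝔄)))
      (U₀ : Z → (B → 𝔄) → (B → 𝔄)) (Umin : Z → (B → 𝔄) → (B → 𝔄)) (B₀ θ₁ C₄ a₃ j a ε₄ : ℝ),
      (∀ z : Z, ∀ W₀ ∈ {V : B → 𝔄 | (∀ b, IsUnit (V b)) ∧ ∀ p ∈ plaqs,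
      ‖V p.1 * V p.2.1 * Ring.inverse (V p.2.2.1) * Ring.inverse (V p.2.2.2) - 1‖ < ε}, IsOpen (O z W₀) ∧ W₀ ∈ O z W₀) ∧
      (∀ z : Z, ∀ W₀ ∈ {V : B → 𝔄 | (∀ b, IsUnit (V b)) ∧ ∀ p ∈ plaqs,
      ‖V p.1 * V p.2.1 * Ring.inverse (V p.2.2.1) * Ring.inverse (V p.2.2.2) - 1‖ < ε}, ∀ V ∈ O z W₀, Regime (𝒢 z W₀ V) (Λ z W₀ V) (W z W₀ V) B₀ θ₁ C₄ a₃ j a ε₄) ∧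
      (∀ z : Z, ∀ W₀ ∈ {V : B → 𝔄 | (∀ b, IsUnit (V b)) ∧ ∀ p ∈ plaqs,
      ‖V p.1 * V p.2.1 * Ring.inverse (V p.2.2.1) * Ring.inverse (V p.2.2.2) - 1‖ < ε}, ∀ V ∈ O z W₀, ‖J z W₀ V‖ ≤ j) ∧
      (∀ z : Z, ∀ W₀ ∈ {V : B → 𝔄 | (∀ b, IsUnit (V b)) ∧ ∀ p ∈ plaqs,
      ‖V p.1 * V p.2.1 * Ring.inverse (V p.2.2.1) * Ring.inverse (V p.2.2.2) - 1‖ < ε}, ∀ V ∈ O z W₀, ‖AH z W₀ V‖ < a) ∧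
      (∀ z : Z, ∀ W₀ ∈ {V : B → 𝔄 | (∀ b, IsUnit (V b)) ∧ ∀ p ∈ plaqs,
      ‖V p.1 * V p.2.1 * Ring.inverse (V p.2.2.1) * Ring.inverse (V p.2.2.2) - 1‖ < ε}, AnalyticOnNhd ℂ (𝒢 z W₀) (O z W₀)) ∧
      (∀ z : Z, ∀ W₀ ∈ {V : B → 𝔄 | (∀ b, IsUnit (V b)) ∧ ∀ p ∈ plaqs,
      ‖V p.1 * V p.2.1 * Ring.inverse (V p.2.2.1) * Ring.inverse (V p.2.2.2) - 1‖ < ε}, AnalyticOnNhd ℂ (Λ z W₀) (O z W₀)) ∧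
      (∀ z : Z, ∀ W₀ ∈ {V : B → 𝔄 | (∀ b, IsUnit (V b)) ∧ ∀ p ∈ plaqs,
      ‖V p.1 * V p.2.1 * Ring.inverse (V p.2.2.1) * Ring.inverse (V p.2.2.2) - 1‖ < ε},
        AnalyticOnNhd ℂ (fun p : (B → 𝔄) × (B → 𝔄) => W z W₀ p.1 p.2) (O z W₀ ×ˢ {Y : B → 𝔄 | ‖Y‖ < a₃})) ∧
      (∀ z : Z, ∀ W₀ ∈ {V : B → 𝔄 | (∀ b, IsUnit (V b)) ∧ ∀ p ∈ plaqs,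
      ‖V p.1 * V p.2.1 * Ring.inverse (V p.2.2.1) * Ring.inverse (V p.2.2.2) - 1‖ < ε}, AnalyticOnNhd ℂ (J z W₀) (O z W₀)) ∧
      (∀ z : Z, ∀ W₀ ∈ {V : B → 𝔄 | (∀ b, IsUnit (V b)) ∧ ∀ p ∈ plaqs,
      ‖V p.1 * V p.2.1 * Ring.inverse (V p.2.2.1) * Ring.inverse (V p.2.2.2) - 1‖ < ε}, AnalyticOnNhd ℂ (AH z W₀) (O z W₀)) ∧
      (∀ z : Z, ∀ W₀ ∈ {V : B → 𝔄 | (∀ b, IsUnit (V b)) ∧ ∀ p ∈ plaqs,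
      ‖V p.1 * V p.2.1 * Ring.inverse (V p.2.2.1) * Ring.inverse (V p.2.2.2) - 1‖ < ε},
        AnalyticOnNhd ℂ (fun p : (B → 𝔄) × (B → 𝔄) => Tm z W₀ p.1 p.2) (O z W₀ ×ˢ {Y : B → 𝔄 | ‖Y‖ < ε₄ + a})) ∧
      (∀ z : Z, ∀ W₀ ∈ {V : B → 𝔄 | (∀ b, IsUnit (V b)) ∧ ∀ p ∈ plaqs,
      ‖V p.1 * V p.2.1 * Ring.inverse (V p.2.2.1) * Ring.inverse (V p.2.2.2) - 1‖ < ε}, ∀ b, IsUnit (U₀ z W₀ b)) ∧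
      (∀ z : Z, ∀ W₀ ∈ {V : B → 𝔄 | (∀ b, IsUnit (V b)) ∧ ∀ p ∈ plaqs,
      ‖V p.1 * V p.2.1 * Ring.inverse (V p.2.2.1) * Ring.inverse (V p.2.2.2) - 1‖ < ε}, ∀ V ∈ O z W₀, Umin z V = fun b =>
        exp (L z W₀ (chartH (𝒢 z W₀ V) (Λ z W₀ V) (W z W₀ V) (J z W₀ V) (Tm z W₀ V) ε₄ (AH z W₀ V)) b) * U₀ z W₀ b) := by
  refine ⟨fun _ _ => univ, fun _ _ _ => 0, fun _ _ _ => 0, fun _ _ _ _ => 0, fun _ _ _ => 0, fun _ _ _ => 0,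
    fun _ _ _ Y => Y, fun _ _ => 0, fun _ _ _ => 1, fun _ _ _ => 1, 0, 0, 0, 2, 0, 1, 0,
    fun _ W₀ _ => ⟨isOpen_univ, mem_univ _⟩, fun _ W₀ _ V _ => ?_, fun _ W₀ _ V _ => by simp, fun _ W₀ _ V _ => by simp,
    fun _ W₀ _ => analyticOnNhd_const, fun _ W₀ _ => analyticOnNhd_const, fun _ W₀ _ => analyticOnNhd_const,
    fun _ W₀ _ => analyticOnNhd_const, fun _ W₀ _ => analyticOnNhd_const, fun _ W₀ _ => fun p _ => analyticAt_snd,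
    fun _ W₀ _ b => isUnit_one, fun _ W₀ _ V _ => ?_⟩
  · -- the level-0 regime: (117)–(121) at zero data and letters `B₀ = θ = C₄ = j = ε₄ = 0`, `a = 1`, `a₃ = 2`
    exact ⟨fun f => by simp, fun Y => by simp, ⟨fun Y _ => by simp, fun P Q => differentiableOn_const _⟩,
      le_rfl, le_rfl, le_rfl, le_rfl, by norm_num, by norm_num, by norm_num⟩
  · -- the reading identity at level 0: `1 = exp (0) · 1`
    funext b
    simp

end Witness

end Summit.QuantumFields.YangMills.Theorems.N21MinimiserResponseExpChart
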